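import Literature.Computability.MetaComplexity.SmolenskyDimensionBound
import HarnessLib

/-!
# The Nie–Wang bound on degree-`D` closures of subsets of the cube

For a set `E ⊆ {0,1}ⁿ` of points of the Boolean cube and a degree bound `D`, let `I_D(E)` be the
space of multilinear polynomials of degree `≤ D` (over a field `F`) vanishing on `E`, and let the
*degree-`D` closure* be `cl_D(E) = {a ∈ {0,1}ⁿ | Q(a) = 0 for all Q ∈ I_D(E)} ⊇ E`. Nie and Wang
(2015) proved `|cl_D(E)| / 2ⁿ ≤ |E| / N_D`, where `N_D = Σ_{j ≤ D} C(n, j)` is the number of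
multilinear monomials of degree `≤ D` (Kopparty–Srinivasan 2018, Thm. A.1, for all fields;
Srinivasan 2023, Thm. 3.6, the form vendored here). The case `|E| < N_D` is the linear-algebra
fact that some non-zero polynomial of degree `≤ D` vanishes on `E` (Srinivasan 2023, Remark 3.7).

Everything is PROVED, in the vocabulary of `SmolenskyProperty.lean` (`CubeFn F n`, `lowDeg F n D`);
the statements follow Kopparty–Srinivasan's Appendix A (`H_D(S)`, `N_D`, `cl_D(S)` on `{0,1}ⁿ` over
an arbitrary field), the proof of the central inequality is a different, self-contained one:

* `numMonomials n D = Σ_{j ≤ D} C(n,j)` and its Pascal recursion;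
* `projOn F Y` (restriction to `Y`, as `v ↦ v·𝟙_Y`) and the affine Hilbert function
  `hilbertFn F Y D = dim (lowDeg F n D)|_Y`;
* `numMonomials_mul_card_le_two_pow_mul_hilbertFn` — the heart of the matter (Kopparty–Srinivasan
  Cor. A.4 = Nie–Wang Thm. 4.1 on the hypercube): `N_D · |Y| ≤ 2ⁿ · h_Y(D)` for EVERY `Y ⊆ {0,1}ⁿ`
  (the fraction of the degree-`≤ D` space visible on `Y` is at least the fraction of points in
  `Y`). Proof (ours, by induction on `n`, splitting the cube along the first coordinate into the
  faces `Y₀, Y₁`): `h_Y(D+1) ≥ h_{Y_c}(D+1) + h_{Y_{¬c}}(D)` for both `c` (project to the face `c`;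
  the kernel contains `x₁^{¬c} · (lowDeg D)|_{Y_{¬c}}`), and `N_{D+1}(n+1) = N_{D+1}(n) + N_D(n)`;
  the printed proofs go through standard monomials (Macaulay) and Kleitman's lemma / FKG instead;
* `finrank_lowDeg` — COROLLARY: `dim lowDeg F n D = Σ_{j ≤ D} C(n,j)` (the monomials are linearly
  independent on the cube; the tree so far had only `≤`, `finrank_lowDeg_le`);
* `closure F D E` and **Theorem 3.6** `card_closure_mul_numMonomials_le`:
  `|cl_D(E)| · N_D ≤ 2ⁿ · |E|`, with the working form `exists_mem_lowDeg_vanish_ne_zero`: if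
  `2ⁿ·|E| < N_D·|E ∪ T|` then some `Q` of degree `≤ D` vanishes on `E` and is non-zero somewhere
  on `T`;
* `eq_zero_of_forall_wt_le` — Fact 3.4 of Srinivasan 2023 (Kopparty–Srinivasan 2018, Lemma 3.3)
  in the form used there: a polynomial of degree `≤ D` on the cube vanishing at every point of
  Hamming weight `≤ D` (a Hamming ball of radius `D` around `0`) vanishes identically; hence
  (`le_of_forall_wt_lt`) a non-zero `R ∈ lowDeg F n D` vanishing at all points of weight `< m`
  has `m ≤ D`.

## References

* Z. Nie, A. Y. Wang, *Hilbert functions and the finite degree Zariski closure in finite field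
  combinatorial geometry*, J. Combin. Theory Ser. A 134 (2015), 196–220 (arXiv:1402.3018), Thm. 4.1
  (`HF(𝔽_qⁿ,d)|Y| ≤ HF(Y,d) qⁿ`), Prop. 5.1, Thm. 5.6 (`HF(𝔽_qⁿ,d)|cl_d(Y)| ≤ qⁿ|Y|`) [NieWang2015].
* S. Kopparty, S. Srinivasan, *Certifying polynomials for AC⁰[⊕] circuits, with applications to
  lower bounds and circuit compression*, Theory of Computing 14 (2018), art. 12, Appendix A:
  Thm. A.1 (`|cl_D(S)|/2ⁿ ≤ |S|/N_D` on `{0,1}ⁿ`, any field), Fact A.2, Lemma A.3, Cor. A.4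
  (`|T|/2ⁿ ≤ H_D(T)/N_D`) [KoppartySrinivasan2018].
* S. Srinivasan, *A robust version of Hegedűs's lemma, with applications*, TheoretiCS 2 (2023),
  art. 5, Fact 3.4, Thm. 3.6, Remark 3.7 [Srinivasan2023].
-/

noncomputable section

namespace Literature.Computability.MetaComplexity

namespace Smolensky

open Finset Module

variable {F : Type*} [Field F] {n : ℕ}

/-! ### The number of monomials of degree at most `D` -/

/-- `N_D = Σ_{j ≤ D} C(n, j)`, the number of multilinear monomials of degree at most `D` in `n`
variables. [cite: KoppartySrinivasan2018, Theorem A.1 (N_D); Srinivasan2023, Theorem 3.6] -/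
def numMonomials (n D : ℕ) : ℕ := ∑ j ∈ range (D + 1), n.choose j

/-- `N_0 = 1`. [folklore] -/
private theorem numMonomials_zero_right (n : ℕ) : numMonomials n 0 = 1 := by
  simp [numMonomials]

/-- In `0` variables there is exactly one monomial. [folklore] -/
private theorem numMonomials_zero_left (D : ℕ) : numMonomials 0 D = 1 := by
  unfold numMonomials
  rw [Finset.sum_range_succ', Nat.choose_zero_right]
  simp

/-- Pascal's rule for `N_D`: `N_{D+1}(n+1) = N_{D+1}(n) + N_D(n)`. [folklore] -/
private theorem numMonomials_succ_succ (n D : ℕ) :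
    numMonomials (n + 1) (D + 1) = numMonomials n (D + 1) + numMonomials n D := by
  unfold numMonomials
  rw [Finset.sum_range_succ' (fun j => (n + 1).choose j), Nat.choose_zero_right]
  simp_rw [Nat.choose_succ_succ']
  rw [Finset.sum_add_distrib, Finset.sum_range_succ' (fun j => n.choose j) (D + 1),
    Nat.choose_zero_right]
  ring

/-- `N_D ≤ 2ⁿ`. [folklore] -/
private theorem numMonomials_le_two_pow (n D : ℕ) : numMonomials n D ≤ 2 ^ n := by
  unfold numMonomials
  calc ∑ j ∈ range (D + 1), n.choose j ≤ ∑ j ∈ range (n + 1), n.choose j := by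
        rcases le_or_gt (D + 1) (n + 1) with h | h
        · exact Finset.sum_le_sum_of_subset (Finset.range_subset_range.2 h)
        · rw [← Finset.sum_range_add_sum_Ico _ h.le]
          have : ∑ j ∈ Ico (n + 1) (D + 1), n.choose j = 0 :=
            Finset.sum_eq_zero fun j hj => Nat.choose_eq_zero_of_lt (by
              have := (Finset.mem_Ico.1 hj).1; omega)
          omega
    _ = 2 ^ n := Nat.sum_range_choose n

/-! ### Restriction to a set of points and the affine Hilbert function -/

/-- Restriction to `Y ⊆ {0,1}ⁿ` (Kopparty–Srinivasan's evaluation vector `P_S`), realised inside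
`CubeFn F n` as `v ↦ v · 𝟙_Y`. [cite: KoppartySrinivasan2018, Appendix A (the evaluation vector P_S)] -/
def projOn (F : Type*) [Field F] {n : ℕ} (Y : Finset (Fin n → Bool)) :
    CubeFn F n →ₗ[F] CubeFn F n where
  toFun v := fun x => if x ∈ Y then v x else 0
  map_add' v w := by
    funext x
    simp only [Pi.add_apply]
    split <;> simp
  map_smul' c v := by
    funext x
    simp only [Pi.smul_apply, smul_eq_mul, RingHom.id_apply]
    split <;> simp

/-- Pointwise formula for `projOn`. [folklore] -/
@[simp] private theorem projOn_apply (Y : Finset (Fin n → Bool)) (v : CubeFn F n) (x : Fin n → Bool) :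
    projOn F Y v x = if x ∈ Y then v x else 0 :=
  rfl

/-- The affine Hilbert function `h_Y(D) = H_D(Y) = dim_F (lowDeg F n D)|_Y`, the dimension of the
space of degree-`≤ D` polynomial functions restricted to `Y`.
[cite: KoppartySrinivasan2018, Appendix A (V_D(S) and H_D(S)); NieWang2015, Theorem 4.1 (HF(Y,d))] -/
def hilbertFn (F : Type*) [Field F] {n : ℕ} (Y : Finset (Fin n → Bool)) (D : ℕ) : ℕ :=
  finrank F ((lowDeg F n D).map (projOn F Y))

/-- `H_D(Y) ≤ dim V(Y) = |Y|`. [cite: KoppartySrinivasan2018, Fact A.2 (2)] -/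
theorem hilbertFn_le_card (Y : Finset (Fin n → Bool)) (D : ℕ) : hilbertFn F Y D ≤ Y.card := by
  refine (Submodule.finrank_mono ?_).trans (finrank_suppOn_le (F := F) Y)
  rintro _ ⟨v, -, rfl⟩
  exact mem_suppOn_of_forall fun b hb => by simp [hb]

/-- `h_Y(D) ≥ 1` for non-empty `Y` (the constants). [folklore] -/
private theorem one_le_hilbertFn {Y : Finset (Fin n → Bool)} (hY : Y.Nonempty) (D : ℕ) :
    1 ≤ hilbertFn F Y D := by
  obtain ⟨y, hy⟩ := hY
  have h1 : (1 : CubeFn F n) ∈ lowDeg F n D := by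
    rw [← mono_empty]
    exact mono_mem_lowDeg (by simp)
  have hmem : projOn F Y 1 ∈ (lowDeg F n D).map (projOn F Y) := Submodule.mem_map_of_mem h1
  have hne : projOn F Y (1 : CubeFn F n) ≠ 0 := by
    intro h
    have := congrFun h y
    simp [hy] at this
  unfold hilbertFn
  exact Module.finrank_pos_iff_exists_ne_zero.2
    ⟨⟨_, hmem⟩, fun h => hne ((Submodule.mk_eq_zero _ _).1 h)⟩

/-- `h_∅(D) = 0`. [folklore] -/
private theorem hilbertFn_empty (D : ℕ) : hilbertFn F (∅ : Finset (Fin n → Bool)) D = 0 :=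
  Nat.le_zero.1 (by simpa using hilbertFn_le_card (F := F) (∅ : Finset (Fin n → Bool)) D)

/-! ### Splitting the cube along the first coordinate -/

/-- The face `Y_c = {x ∈ {0,1}ⁿ | (c, x) ∈ Y}` of `Y ⊆ {0,1}ⁿ⁺¹`. [folklore] -/
def face (c : Bool) (Y : Finset (Fin (n + 1) → Bool)) : Finset (Fin n → Bool) :=
  univ.filter fun x => (Fin.cons c x : Fin (n + 1) → Bool) ∈ Y

/-- Membership in a face. [folklore] -/
@[simp] private theorem mem_face {c : Bool} {Y : Finset (Fin (n + 1) → Bool)} {x : Fin n → Bool} :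
    x ∈ face c Y ↔ (Fin.cons c x : Fin (n + 1) → Bool) ∈ Y := by
  simp [face]

/-- `|Y| = |Y₀| + |Y₁|`. [folklore] -/
private theorem card_eq_card_face_add (Y : Finset (Fin (n + 1) → Bool)) :
    Y.card = (face false Y).card + (face true Y).card := by
  classical
  have hsplit : Y = (Y.filter fun z => z 0 = false) ∪ Y.filter fun z => z 0 = true := by
    ext z; cases h : z 0 <;> simp [h]
  have hdisj : Disjoint (Y.filter fun z => z 0 = false) (Y.filter fun z => z 0 = true) :=
    Finset.disjoint_filter.2 fun z _ h1 h2 => by simp [h1] at h2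
  have hc : ∀ c : Bool, (Y.filter fun z => z 0 = c).card = (face c Y).card := by
    intro c
    refine Finset.card_bij (fun z _ => Fin.tail z) (fun z hz => ?_) (fun z hz w hw h => ?_)
      (fun x hx => ?_)
    · rw [Finset.mem_filter] at hz
      rw [mem_face, ← hz.2, Fin.cons_self_tail]
      exact hz.1
    · rw [Finset.mem_filter] at hz hw
      rw [← Fin.cons_self_tail z, ← Fin.cons_self_tail w, h, hz.2, hw.2]
    · refine ⟨Fin.cons c x, ?_, Fin.tail_cons _ _⟩
      rw [Finset.mem_filter]
      exact ⟨mem_face.1 hx, Fin.cons_zero _ _⟩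
  rw [← hc, ← hc, ← Finset.card_union_of_disjoint hdisj, ← hsplit]

/-- Restriction to the face `x₁ = c`: `(σ_c P)(x) = P(c, x)`. [folklore] -/
def sliceAt (F : Type*) [Field F] {n : ℕ} (c : Bool) : CubeFn F (n + 1) →ₗ[F] CubeFn F n where
  toFun P := fun x => P (Fin.cons c x)
  map_add' _ _ := rfl
  map_smul' _ _ := rfl

/-- Pointwise formula for `sliceAt`. [folklore] -/
@[simp] private theorem sliceAt_apply (c : Bool) (P : CubeFn F (n + 1)) (x : Fin n → Bool) :
    sliceAt F c P x = P (Fin.cons c x) :=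
  rfl

/-- Lifting a function of `x₂, …, x_{n+1}` to the bigger cube (ignore `x₁`). [folklore] -/
def liftFn (F : Type*) [Field F] {n : ℕ} : CubeFn F n →ₗ[F] CubeFn F (n + 1) where
  toFun f := fun z => f (Fin.tail z)
  map_add' _ _ := rfl
  map_smul' _ _ := rfl

/-- Pointwise formula for `liftFn`. [folklore] -/
@[simp] private theorem liftFn_apply (f : CubeFn F n) (z : Fin (n + 1) → Bool) :
    liftFn F f z = f (Fin.tail z) :=
  rfl

/-- Lifting and multiplying by the literal `[x₁ = c]`: `(λ_c g)(z) = [z₁ = c] · g(z₂, …)`. [folklore] -/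
def liftMul (F : Type*) [Field F] {n : ℕ} (c : Bool) : CubeFn F n →ₗ[F] CubeFn F (n + 1) where
  toFun g := fun z => if z 0 = c then g (Fin.tail z) else 0
  map_add' f g := by
    funext z
    simp only [Pi.add_apply]
    split <;> simp
  map_smul' a f := by
    funext z
    simp only [Pi.smul_apply, smul_eq_mul, RingHom.id_apply]
    split <;> simp

/-- Pointwise formula for `liftMul`. [folklore] -/
@[simp] private theorem liftMul_apply (c : Bool) (g : CubeFn F n) (z : Fin (n + 1) → Bool) :
    liftMul F c g z = if z 0 = c then g (Fin.tail z) else 0 :=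
  rfl

/-- `σ_{c'} (liftFn f) = f`. [folklore] -/
private theorem sliceAt_liftFn (c' : Bool) (f : CubeFn F n) : sliceAt F c' (liftFn F f) = f := by
  funext x
  simp [Fin.tail_cons]

/-- `σ_{c'} (λ_c g) = [c' = c] g`. [folklore] -/
private theorem sliceAt_liftMul (c' c : Bool) (g : CubeFn F n) :
    sliceAt F c' (liftMul F c g) = if c' = c then g else 0 := by
  funext x
  simp only [sliceAt_apply, liftMul_apply, Fin.cons_zero, Fin.tail_cons]
  split <;> rfl

/-- Slices of a projection are projections of slices: `σ_c (v·𝟙_Y) = (σ_c v)·𝟙_{Y_c}`. [folklore] -/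
private theorem sliceAt_projOn (c : Bool) (Y : Finset (Fin (n + 1) → Bool)) (v : CubeFn F (n + 1)) :
    sliceAt F c (projOn F Y v) = projOn F (face c Y) (sliceAt F c v) := by
  funext x
  simp only [sliceAt_apply, projOn_apply, mem_face]

/-- A point of the cube is determined by its first coordinate and its tail. [folklore] -/
private theorem eq_of_sliceAt_eq {v w : CubeFn F (n + 1)} (h : ∀ c, sliceAt F c v = sliceAt F c w) :
    v = w := by
  funext z
  have := congrFun (h (z 0)) (Fin.tail z)
  simpa only [sliceAt_apply, Fin.cons_self_tail] using this

/-! ### The degree filtration under slicing and lifting -/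

/-- The tail `{j | j+1 ∈ S}` of a set of coordinates of `{0,1}ⁿ⁺¹`. [folklore] -/
def tailSet (S : Finset (Fin (n + 1))) : Finset (Fin n) := univ.filter fun j => j.succ ∈ S

/-- `|tailSet S| ≤ |S|`. [folklore] -/
private theorem card_tailSet_le (S : Finset (Fin (n + 1))) : (tailSet S).card ≤ S.card := by
  refine Finset.card_le_card_of_injOn Fin.succ (fun j hj => ?_) ((Fin.succ_injective n).injOn)
  simpa [tailSet] using hj

/-- If `0 ∈ S` then `|tailSet S| + 1 = |S|`. [folklore] -/
private theorem card_tailSet_succ {S : Finset (Fin (n + 1))} (h0 : (0 : Fin (n + 1)) ∈ S) :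
    (tailSet S).card + 1 = S.card := by
  have himage : (tailSet S).image Fin.succ = S.erase 0 := by
    ext i
    simp only [Finset.mem_image, tailSet, Finset.mem_filter, Finset.mem_univ, true_and,
      Finset.mem_erase]
    constructor
    · rintro ⟨j, hj, rfl⟩
      exact ⟨Fin.succ_ne_zero j, hj⟩
    · rintro ⟨hi, hiS⟩
      obtain ⟨j, rfl⟩ := Fin.exists_succ_eq.2 hi
      exact ⟨j, hiS, rfl⟩
  rw [← Finset.card_image_of_injective (tailSet S) (Fin.succ_injective n), himage,
    Finset.card_erase_add_one h0]

/-- A monomial sliced: `σ_c (x_S) = x_{tailSet S}` if `0 ∉ S` or `c = 1`, and `0` otherwise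
(on the Boolean cube a substituted monomial is `0` or a monomial of no larger degree).
[cite: JuknaBFC2012, §2.1 (multilinear monomials on the Boolean cube under substitution)] -/
theorem sliceAt_mono (c : Bool) (S : Finset (Fin (n + 1))) :
    sliceAt F c (mono F S) =
      if (0 : Fin (n + 1)) ∈ S → c = true then mono F (tailSet S) else 0 := by
  funext x
  simp only [sliceAt_apply, mono_apply]
  have key : (∀ i ∈ S, (Fin.cons c x : Fin (n + 1) → Bool) i = true) ↔
      ((0 : Fin (n + 1)) ∈ S → c = true) ∧ ∀ j ∈ tailSet S, x j = true := by
    constructor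
    · intro h
      refine ⟨fun h0 => by simpa using h 0 h0, fun j hj => ?_⟩
      have hj' : j.succ ∈ S := by simpa [tailSet] using hj
      simpa using h _ hj'
    · rintro ⟨h0, ht⟩ i hi
      refine Fin.cases (fun hi => ?_) (fun j hj => ?_) i hi
      · simpa using h0 hi
      · have : j ∈ tailSet S := by simpa [tailSet] using hj
        simpa using ht j this
  by_cases h0 : (0 : Fin (n + 1)) ∈ S → c = true
  · rw [if_pos h0]
    simp only [mono_apply]
    by_cases ht : ∀ j ∈ tailSet S, x j = true
    · rw [if_pos (key.2 ⟨h0, ht⟩), if_pos ht]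
    · rw [if_neg fun h => ht (key.1 h).2, if_neg ht]
  · rw [if_neg h0, Pi.zero_apply, if_neg fun h => h0 (key.1 h).1]

/-- Slicing preserves the degree filtration: `σ_c (lowDeg (n+1) D) ⊆ lowDeg n D` (restriction
`x₁ := c` does not raise the degree). [cite: JuknaBFC2012, §2.1 (restrictions of multilinear polynomials)] -/
theorem sliceAt_mem_lowDeg (c : Bool) {D : ℕ} {P : CubeFn F (n + 1)} (hP : P ∈ lowDeg F (n + 1) D) :
    sliceAt F c P ∈ lowDeg F n D := by
  have hle : (lowDeg F (n + 1) D).map (sliceAt F c) ≤ lowDeg F n D := by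
    rw [lowDeg_eq_span (D := D) (n := n + 1), Submodule.map_span_le]
    rintro _ ⟨⟨S, hS⟩, rfl⟩
    dsimp only
    rw [sliceAt_mono]
    split
    · exact mono_mem_lowDeg ((card_tailSet_le S).trans hS)
    · exact Submodule.zero_mem _
  exact hle (Submodule.mem_map_of_mem hP)

/-- The difference of the two slices drops one degree: `σ_1 P - σ_0 P ∈ lowDeg n D` for
`P ∈ lowDeg (n+1) (D+1)` (it is the coefficient of `x₁` in `P = P|_{x₁=0} + x₁·(P|_{x₁=1} - P|_{x₁=0})`).
[cite: JuknaBFC2012, §2.1 (multilinear polynomials: the coefficient of a variable)] -/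
theorem sliceAt_sub_sliceAt_mem_lowDeg {D : ℕ} {P : CubeFn F (n + 1)}
    (hP : P ∈ lowDeg F (n + 1) (D + 1)) :
    sliceAt F true P - sliceAt F false P ∈ lowDeg F n D := by
  have hle : (lowDeg F (n + 1) (D + 1)).map (sliceAt F true - sliceAt F false) ≤ lowDeg F n D := by
    rw [lowDeg_eq_span (D := D + 1) (n := n + 1), Submodule.map_span_le]
    rintro _ ⟨⟨S, hS⟩, rfl⟩
    dsimp only
    rw [LinearMap.sub_apply, sliceAt_mono, sliceAt_mono]
    by_cases h0 : (0 : Fin (n + 1)) ∈ S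
    · rw [if_pos fun _ => rfl, if_neg fun h => Bool.false_ne_true (h h0), sub_zero]
      refine mono_mem_lowDeg ?_
      have := card_tailSet_succ h0
      omega
    · rw [if_pos fun h => (h0 h).elim, if_pos fun h => (h0 h).elim, sub_self]
      exact Submodule.zero_mem _
  exact hle (Submodule.mem_map_of_mem hP)

/-- `liftFn (x_T) = x_{T+1}` (shift of coordinates). [folklore] -/
private theorem liftFn_mono (T : Finset (Fin n)) : liftFn F (mono F T) = mono F (T.map (Fin.succEmb n)) := by
  funext z
  simp only [liftFn_apply, mono_apply, Finset.forall_mem_map]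
  rfl

/-- `λ_1 (x_T) = x_1 · x_{T+1}`. [folklore] -/
private theorem liftMul_true_mono (T : Finset (Fin n)) :
    liftMul F true (mono F T) = mono F (insert 0 (T.map (Fin.succEmb n))) := by
  funext z
  simp only [liftMul_apply, mono_apply, Finset.forall_mem_insert, Finset.forall_mem_map]
  by_cases h0 : z 0 = true
  · rw [if_pos h0]
    simp only [h0, true_and]
    rfl
  · rw [if_neg h0, if_neg fun h => h0 h.1]

/-- `λ_0 (x_T) = x_{T+1} - x_1 · x_{T+1}`. [folklore] -/
private theorem liftMul_false_mono (T : Finset (Fin n)) :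
    liftMul F false (mono F T) =
      mono F (T.map (Fin.succEmb n)) - mono F (insert 0 (T.map (Fin.succEmb n))) := by
  rw [← liftMul_true_mono, ← liftFn_mono]
  funext z
  simp only [liftMul_apply, liftFn_apply, Pi.sub_apply]
  cases z 0 <;> simp

/-- `liftFn` preserves the degree filtration (a polynomial in `x₂,…,x_{n+1}` is a polynomial in
`x₁,…,x_{n+1}` of the same degree). [cite: JuknaBFC2012, §2.1 (multilinear polynomials on the Boolean cube)] -/
theorem liftFn_mem_lowDeg {D : ℕ} {f : CubeFn F n} (hf : f ∈ lowDeg F n D) :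
    liftFn F f ∈ lowDeg F (n + 1) D := by
  have hle : (lowDeg F n D).map (liftFn F) ≤ lowDeg F (n + 1) D := by
    rw [lowDeg_eq_span (D := D) (n := n), Submodule.map_span_le]
    rintro _ ⟨⟨T, hT⟩, rfl⟩
    dsimp only
    rw [liftFn_mono]
    exact mono_mem_lowDeg (by rwa [Finset.card_map])
  exact hle (Submodule.mem_map_of_mem hf)

/-- `liftMul c` raises the degree by at most one (multiplication by the literal `x₁` or `1 - x₁`).
[cite: JuknaBFC2012, §2.1 (multilinear polynomials on the Boolean cube)] -/
theorem liftMul_mem_lowDeg (c : Bool) {D : ℕ} {g : CubeFn F n} (hg : g ∈ lowDeg F n D) :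
    liftMul F c g ∈ lowDeg F (n + 1) (D + 1) := by
  have hcard : ∀ T : Finset (Fin n), T.card ≤ D →
      (insert (0 : Fin (n + 1)) (T.map (Fin.succEmb n))).card ≤ D + 1 := fun T hT =>
    (Finset.card_insert_le _ _).trans (by rw [Finset.card_map]; omega)
  have hle : (lowDeg F n D).map (liftMul F c) ≤ lowDeg F (n + 1) (D + 1) := by
    rw [lowDeg_eq_span (D := D) (n := n), Submodule.map_span_le]
    rintro _ ⟨⟨T, hT⟩, rfl⟩
    dsimp only
    cases c
    · rw [liftMul_false_mono]
      refine Submodule.sub_mem _ (mono_mem_lowDeg ?_) (mono_mem_lowDeg (hcard T hT))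
      rw [Finset.card_map]; omega
    · rw [liftMul_true_mono]
      exact mono_mem_lowDeg (hcard T hT)
  exact hle (Submodule.mem_map_of_mem hg)

/-! ### The key inequality and the main bound -/

/-- **Splitting inequality**: `h_Y(D+1) ≥ h_{Y_c}(D+1) + h_{Y_{¬c}}(D)` — project `(lowDeg (D+1))|_Y`
onto the face `x₁ = c`; the kernel contains `([x₁ = ¬c] · lowDeg D)|_Y ≅ (lowDeg D)|_{Y_{¬c}}`.
This is our inductive replacement for the standard-monomial / Kleitman-lemma step of the printed
proofs. [cite: KoppartySrinivasan2018, Corollary A.4 (proof, inductive variant); NieWang2015, Theorem 4.1 (proof, inductive variant)] -/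
theorem hilbertFn_face_add_le (c : Bool) (Y : Finset (Fin (n + 1) → Bool)) (D : ℕ) :
    hilbertFn F (face c Y) (D + 1) + hilbertFn F (face (!c) Y) D ≤ hilbertFn F Y (D + 1) := by
  set W : Submodule F (CubeFn F (n + 1)) := (lowDeg F (n + 1) (D + 1)).map (projOn F Y) with hW
  set g : W →ₗ[F] CubeFn F n := (sliceAt F c).comp W.subtype with hg
  have hrank : finrank F (LinearMap.range g) + finrank F (LinearMap.ker g) = finrank F W :=
    LinearMap.finrank_range_add_finrank_ker g
  -- the range contains `(lowDeg n (D+1))|_{Y_c}`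
  have hrange : (lowDeg F n (D + 1)).map (projOn F (face c Y)) ≤ LinearMap.range g := by
    rintro _ ⟨f, hf, rfl⟩
    have hmem : projOn F Y (liftFn F f) ∈ W := Submodule.mem_map_of_mem (liftFn_mem_lowDeg hf)
    refine ⟨⟨_, hmem⟩, ?_⟩
    rw [hg, LinearMap.comp_apply, Submodule.subtype_apply, sliceAt_projOn, sliceAt_liftFn]
  -- the kernel contains `([x₁ = ¬c] · lowDeg n D)|_Y`
  set V : Submodule F (CubeFn F (n + 1)) :=
    (lowDeg F n D).map ((projOn F Y).comp (liftMul F (!c))) with hV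
  have hVW : V ≤ W := by
    rintro _ ⟨g', hg', rfl⟩
    exact Submodule.mem_map_of_mem (liftMul_mem_lowDeg (!c) hg')
  have hVker : V ≤ LinearMap.ker (sliceAt F c) := by
    rintro _ ⟨g', hg', rfl⟩
    rw [LinearMap.mem_ker, LinearMap.comp_apply, sliceAt_projOn, sliceAt_liftMul, if_neg]
    · exact LinearMap.map_zero _
    · cases c <;> decide
  have hker : finrank F V ≤ finrank F (LinearMap.ker g) := by
    have h1 : (LinearMap.ker g).map W.subtype = W ⊓ LinearMap.ker (sliceAt F c) := by
      rw [hg, LinearMap.ker_comp, Submodule.map_comap_subtype]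
    rw [← Submodule.finrank_map_subtype_eq W (LinearMap.ker g), h1]
    exact Submodule.finrank_mono (le_inf hVW hVker)
  -- and `V` maps onto `(lowDeg n D)|_{Y_{¬c}}` under the other slice
  have hVonto : (lowDeg F n D).map (projOn F (face (!c) Y)) ≤ V.map (sliceAt F (!c)) := by
    rintro _ ⟨g', hg', rfl⟩
    refine ⟨(projOn F Y) (liftMul F (!c) g'), Submodule.mem_map_of_mem hg', ?_⟩
    rw [sliceAt_projOn, sliceAt_liftMul, if_pos rfl]
  have hV' : hilbertFn F (face (!c) Y) D ≤ finrank F V :=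
    (Submodule.finrank_mono hVonto).trans (Submodule.finrank_map_le _ _)
  have hR : hilbertFn F (face c Y) (D + 1) ≤ finrank F (LinearMap.range g) :=
    Submodule.finrank_mono hrange
  unfold hilbertFn at hV' hR ⊢
  rw [← hW, ← hrank]
  omega

/-- **The Nie–Wang inequality** (Kopparty–Srinivasan Cor. A.4: "`|T|/2ⁿ ≤ H_D(T)/N_D`"; Nie–Wang
Thm. 4.1 for `𝔽_qⁿ`): for every `Y ⊆ {0,1}ⁿ` and every `D`, `N_D · |Y| ≤ 2ⁿ · h_Y(D)` — the
degree-`≤ D` polynomials restricted to `Y` span at least the fraction `|Y|/2ⁿ` of their number `N_D`.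
[cite: KoppartySrinivasan2018, Corollary A.4; NieWang2015, Theorem 4.1] -/
theorem numMonomials_mul_card_le_two_pow_mul_hilbertFn (Y : Finset (Fin n → Bool)) (D : ℕ) :
    numMonomials n D * Y.card ≤ 2 ^ n * hilbertFn F Y D := by
  induction n generalizing D with
  | zero =>
    rw [numMonomials_zero_left, one_mul, pow_zero, one_mul]
    rcases Y.eq_empty_or_nonempty with rfl | hY
    · simp
    · refine (Finset.card_le_univ Y).trans ?_
      rw [Fintype.card_fun, Fintype.card_bool, Fintype.card_fin, pow_zero]
      exact one_le_hilbertFn hY D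
  | succ n ih =>
    cases D with
    | zero =>
      rw [numMonomials_zero_right, one_mul]
      rcases Y.eq_empty_or_nonempty with rfl | hY
      · simp
      · calc Y.card ≤ 2 ^ (n + 1) := by
              refine (Finset.card_le_univ Y).trans ?_
              rw [Fintype.card_fun, Fintype.card_bool, Fintype.card_fin]
          _ ≤ 2 ^ (n + 1) * hilbertFn F Y 0 := Nat.le_mul_of_pos_right _ (one_le_hilbertFn hY 0)
    | succ D =>
      have h0 := hilbertFn_face_add_le (F := F) false Y D
      have h1 := hilbertFn_face_add_le (F := F) true Y D
      simp only [Bool.not_false, Bool.not_true] at h0 h1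
      have i1 := ih (face false Y) (D + 1)
      have i2 := ih (face true Y) (D + 1)
      have i3 := ih (face false Y) D
      have i4 := ih (face true Y) D
      rw [numMonomials_succ_succ, card_eq_card_face_add Y, pow_succ]
      calc (numMonomials n (D + 1) + numMonomials n D) *
            ((face false Y).card + (face true Y).card)
          = numMonomials n (D + 1) * (face false Y).card
              + numMonomials n (D + 1) * (face true Y).card
              + numMonomials n D * (face false Y).card
              + numMonomials n D * (face true Y).card := by ring
        _ ≤ 2 ^ n * hilbertFn F (face false Y) (D + 1)
              + 2 ^ n * hilbertFn F (face true Y) (D + 1)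
              + 2 ^ n * hilbertFn F (face false Y) D
              + 2 ^ n * hilbertFn F (face true Y) D :=
            add_le_add (add_le_add (add_le_add i1 i2) i3) i4
        _ = 2 ^ n * ((hilbertFn F (face false Y) (D + 1) + hilbertFn F (face true Y) D)
              + (hilbertFn F (face true Y) (D + 1) + hilbertFn F (face false Y) D)) := by ring
        _ ≤ 2 ^ n * (hilbertFn F Y (D + 1) + hilbertFn F Y (D + 1)) :=
            Nat.mul_le_mul_left _ (add_le_add h0 h1)
        _ = 2 ^ n * 2 * hilbertFn F Y (D + 1) := by ring

/-- **`dim lowDeg F n D = Σ_{j ≤ D} C(n,j) = N_D`**: the multilinear monomials of degree `≤ D` are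
linearly independent as functions on the cube (take `Y = {0,1}ⁿ` above; the bound `≤` is
`finrank_lowDeg_le`). [cite: KoppartySrinivasan2018, Fact A.2 (4) (H_D({0,1}ⁿ) = N_D)] -/
theorem finrank_lowDeg (D : ℕ) : finrank F (lowDeg F n D) = ∑ j ∈ range (D + 1), n.choose j := by
  refine le_antisymm (finrank_lowDeg_le D) ?_
  have h := numMonomials_mul_card_le_two_pow_mul_hilbertFn (F := F)
    (univ : Finset (Fin n → Bool)) D
  have hid : (lowDeg F n D).map (projOn F (univ : Finset (Fin n → Bool))) = lowDeg F n D := by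
    have : projOn F (univ : Finset (Fin n → Bool)) = LinearMap.id :=
      LinearMap.ext fun v => funext fun x => by simp
    rw [this, Submodule.map_id]
  rw [hilbertFn, hid, Finset.card_univ, Fintype.card_fun, Fintype.card_bool, Fintype.card_fin]
    at h
  have hpos : 0 < 2 ^ n := pow_pos (by norm_num) n
  rw [mul_comm] at h
  exact le_of_mul_le_mul_left h hpos

/-! ### Degree-`D` closures (Theorem 3.6) -/

/-- The degree-`D` closure `cl_D(E) = {a | Q(a) = 0 for every Q of degree ≤ D vanishing on E}`.
[cite: Srinivasan2023, Theorem 3.6 (definition of cl_D); KoppartySrinivasan2018, Appendix A (cl_D(S)); NieWang2015, §5 (cl_d(Y))] -/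
def closure (F : Type*) [Field F] {n : ℕ} (D : ℕ) (E : Finset (Fin n → Bool)) :
    Finset (Fin n → Bool) := by
  classical
  exact univ.filter fun a => ∀ Q ∈ lowDeg F n D, (∀ e ∈ E, Q e = 0) → Q a = 0

/-- Membership in the closure (the defining property of `cl_D`). [cite: Srinivasan2023, Theorem 3.6 (definition of cl_D)] -/
theorem mem_closure {D : ℕ} {E : Finset (Fin n → Bool)} {a : Fin n → Bool} :
    a ∈ closure F D E ↔ ∀ Q ∈ lowDeg F n D, (∀ e ∈ E, Q e = 0) → Q a = 0 := by
  classical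
  simp [closure]

/-- `E ⊆ cl_D(E)`. [cite: Srinivasan2023, Theorem 3.6 (cl_D(E) ⊇ E); NieWang2015, Proposition 5.1 (1)] -/
theorem subset_closure (D : ℕ) (E : Finset (Fin n → Bool)) : E ⊆ closure F D E :=
  fun e he => mem_closure.2 fun _ _ hQ => hQ e he

/-- If every degree-`≤ D` polynomial vanishing on `E` vanishes on `Y ⊇ E`, then `h_Y(D) ≤ |E|`
(restriction from `Y` to `E` is injective on `(lowDeg D)|_Y`: "the linear map `ρ : V_D(T) → V_D(S)`
… has trivial kernel"). [cite: KoppartySrinivasan2018, Theorem A.1 (proof)] -/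
theorem hilbertFn_le_card_of_vanish {D : ℕ} {E Y : Finset (Fin n → Bool)} (hEY : E ⊆ Y)
    (hvan : ∀ Q ∈ lowDeg F n D, (∀ e ∈ E, Q e = 0) → ∀ y ∈ Y, Q y = 0) :
    hilbertFn F Y D ≤ E.card := by
  set W : Submodule F (CubeFn F n) := (lowDeg F n D).map (projOn F Y) with hW
  set g : W →ₗ[F] CubeFn F n := (projOn F E).comp W.subtype with hg
  have hinj : Function.Injective g := by
    rw [← LinearMap.ker_eq_bot, LinearMap.ker_eq_bot']
    rintro ⟨_, Q, hQ, rfl⟩ h0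
    rw [hg, LinearMap.comp_apply, Submodule.subtype_apply] at h0
    have hE : ∀ e ∈ E, Q e = 0 := fun e he => by
      have := congrFun h0 e
      simpa [he, hEY he] using this
    have hY : projOn F Y Q = 0 := by
      funext y
      by_cases hy : y ∈ Y
      · simpa [hy] using hvan Q hQ hE y hy
      · simp [hy]
    exact Subtype.ext hY
  have hrange : LinearMap.range g ≤ suppOn F E := by
    rintro _ ⟨w, rfl⟩
    exact mem_suppOn_of_forall fun b hb => by simp [hg, hb]
  calc hilbertFn F Y D = finrank F W := rfl
    _ = finrank F (LinearMap.range g) := (LinearMap.finrank_range_of_inj hinj).symm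
    _ ≤ finrank F (suppOn F E) := Submodule.finrank_mono hrange
    _ ≤ E.card := finrank_suppOn_le E

/-- **Theorem 3.6 (Nie–Wang; Kopparty–Srinivasan Thm. A.1; Srinivasan 2023 Thm. 3.6):**
`|cl_D(E)| · N_D ≤ 2ⁿ · |E|`, i.e. `|cl_D(E)|/2ⁿ ≤ |E|/N_D`, over any field.
[cite: Srinivasan2023, Theorem 3.6; NieWang2015, Thm. 1.7; KoppartySrinivasan2018, Theorem A.1] -/
theorem card_closure_mul_numMonomials_le (D : ℕ) (E : Finset (Fin n → Bool)) :
    (closure F D E).card * numMonomials n D ≤ 2 ^ n * E.card := by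
  have h1 := numMonomials_mul_card_le_two_pow_mul_hilbertFn (F := F) (closure F D E) D
  have h2 : hilbertFn F (closure F D E) D ≤ E.card :=
    hilbertFn_le_card_of_vanish (subset_closure D E) fun Q hQ hE y hy => (mem_closure.1 hy) Q hQ hE
  calc (closure F D E).card * numMonomials n D = numMonomials n D * (closure F D E).card :=
        mul_comm _ _
    _ ≤ 2 ^ n * hilbertFn F (closure F D E) D := h1
    _ ≤ 2 ^ n * E.card := Nat.mul_le_mul_left _ h2

/-- Remark 3.7: if `|E| < N_D` then `cl_D(E) ≠ {0,1}ⁿ`, i.e. some non-zero polynomial of degree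
`≤ D` vanishes on `E`. [cite: Srinivasan2023, Remark 3.7] -/
theorem card_closure_lt_of_card_lt {D : ℕ} {E : Finset (Fin n → Bool)}
    (h : E.card < numMonomials n D) : (closure F D E).card < 2 ^ n := by
  by_contra hge
  rw [not_lt] at hge
  have h1 := card_closure_mul_numMonomials_le (F := F) D E
  have hpos : 0 < 2 ^ n := pow_pos (by norm_num) n
  have : 2 ^ n * numMonomials n D ≤ 2 ^ n * E.card :=
    (Nat.mul_le_mul_right _ hge).trans h1
  have := le_of_mul_le_mul_left this hpos
  omega

/-- **Working form of Theorem 3.6**: if `2ⁿ · |E| < N_D · |E ∪ T|`, some polynomial of degree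
`≤ D` vanishes on `E` but not everywhere on `T` (as used in the proof of Srinivasan's Claim 3.9:
`|cl_D(E)| < |E'|` forces `cl_D(E) ⊉ E'`). [cite: Srinivasan2023, Theorem 3.6 and Claim 3.9] -/
theorem exists_mem_lowDeg_vanish_ne_zero {D : ℕ} {E T : Finset (Fin n → Bool)}
    (h : 2 ^ n * E.card < numMonomials n D * (E ∪ T).card) :
    ∃ Q ∈ lowDeg F n D, (∀ e ∈ E, Q e = 0) ∧ ∃ a ∈ T, Q a ≠ 0 := by
  classical
  by_contra hcon
  push Not at hcon
  have hsub : E ∪ T ⊆ closure F D E := by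
    intro a ha
    rcases Finset.mem_union.1 ha with ha | ha
    · exact subset_closure D E ha
    · exact mem_closure.2 fun Q hQ hE => hcon Q hQ hE a ha
  have h1 := card_closure_mul_numMonomials_le (F := F) D E
  have h2 : numMonomials n D * (E ∪ T).card ≤ (closure F D E).card * numMonomials n D := by
    rw [mul_comm]
    exact Nat.mul_le_mul_right _ (Finset.card_le_card hsub)
  omega

/-! ### Fact 3.4: vanishing on a Hamming ball -/

/-- `lowDeg F n 0` consists of the constants (a degree-`0` polynomial function is determined by
its value at any one point). [cite: Srinivasan2023, Fact 3.4 (the case d = 0)] -/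
theorem eq_const_of_mem_lowDeg_zero {P : CubeFn F n} (hP : P ∈ lowDeg F n 0) (a : Fin n → Bool) :
    P = P a • (1 : CubeFn F n) := by
  have hspan : lowDeg F n 0 ≤ Submodule.span F {(1 : CubeFn F n)} := by
    rw [lowDeg_eq_span (D := 0), Submodule.span_le]
    rintro _ ⟨⟨S, hS⟩, rfl⟩
    have hS0 : S = ∅ := Finset.card_eq_zero.1 (Nat.le_zero.1 hS)
    simp only [hS0, mono_empty]
    exact Submodule.subset_span rfl
  obtain ⟨c, hc⟩ := Submodule.mem_span_singleton.1 (hspan hP)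
  have hca : c = P a := by
    have := congrFun hc a
    simpa using this
  rw [← hca, hc]

/-- The Hamming weight of `(c, x)` is that of `x` plus `[c = 1]`. [folklore] -/
private theorem card_filter_cons (c : Bool) (x : Fin n → Bool) :
    (univ.filter fun i => (Fin.cons c x : Fin (n + 1) → Bool) i = true).card =
      (if c = true then 1 else 0) + (univ.filter fun j => x j = true).card := by
  rw [Finset.card_filter, Finset.card_filter, Fin.sum_univ_succ]
  simp only [Fin.cons_zero, Fin.cons_succ]

/-- **Fact 3.4** (Kopparty–Srinivasan Lemma 3.3; Srinivasan 2023 Fact 3.4, ball around `0`): a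
polynomial function of degree `≤ D` on `{0,1}ⁿ` vanishing at every point of Hamming weight `≤ D`
vanishes identically. [cite: Srinivasan2023, Fact 3.4; KoppartySrinivasan2018, Lemma 3.3] -/
theorem eq_zero_of_forall_wt_le {D : ℕ} {R : CubeFn F n} (hR : R ∈ lowDeg F n D)
    (h0 : ∀ a : Fin n → Bool, (univ.filter fun i => a i = true).card ≤ D → R a = 0) : R = 0 := by
  induction n generalizing D with
  | zero =>
    funext a
    have ha : a = fun i => Fin.elim0 i := funext fun i => Fin.elim0 i
    refine h0 a ?_
    rw [ha]
    simp
  | succ n ih =>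
    cases D with
    | zero =>
      rw [eq_const_of_mem_lowDeg_zero hR (fun _ => false), h0 _ (by simp), zero_smul]
    | succ D =>
      have hf : sliceAt F false R = 0 := by
        refine ih (sliceAt_mem_lowDeg false hR) fun x hx => ?_
        rw [sliceAt_apply]
        exact h0 _ (by rw [card_filter_cons]; simpa using hx)
      have hg : sliceAt F true R - sliceAt F false R = 0 := by
        refine ih (sliceAt_sub_sliceAt_mem_lowDeg hR) fun x hx => ?_
        rw [Pi.sub_apply, sliceAt_apply, sliceAt_apply,
          h0 _ (by rw [card_filter_cons]; simp; omega),
          h0 _ (by rw [card_filter_cons]; simp; omega), sub_zero]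
      have ht : sliceAt F true R = 0 := by rwa [hf, sub_zero] at hg
      refine eq_of_sliceAt_eq fun c => ?_
      rw [LinearMap.map_zero]
      cases c
      · exact hf
      · exact ht

/-- Hence a NON-ZERO `R ∈ lowDeg F n D` vanishing at all points of weight `< m` has `m ≤ D`
(the form used in the proof of Srinivasan's Lemma 3.2: `deg R ≥ m`).
[cite: Srinivasan2023, Fact 3.4 (as applied in the proof of Lemma 3.2)] -/
theorem le_of_forall_wt_lt {D m : ℕ} {R : CubeFn F n} (hR : R ∈ lowDeg F n D)
    (h0 : ∀ a : Fin n → Bool, (univ.filter fun i => a i = true).card < m → R a = 0)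
    {a₀ : Fin n → Bool} (ha₀ : R a₀ ≠ 0) : m ≤ D := by
  by_contra hlt
  rw [not_le] at hlt
  exact ha₀ (congrFun (eq_zero_of_forall_wt_le hR fun a ha => h0 a (by omega)) a₀)

end Smolensky

end Literature.Computability.MetaComplexity
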